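import Literature.AnabelianGeometry.AbsoluteAnabelian.DiagramsOfCategories

/-!
# Strict (structurally recursive) path functors and families of homotopies built from strict data
# ([AbsTopIII] Definition 3.5 (i), (ii), (iii): technical companion of `DiagramsOfCategories.lean`)

S. Mochizuki, *Topics in Absolute Anabelian Geometry III* (bib key `MochizukiAbsTopIII2015`; locators =
kurims manuscript pages, lit key `paper:url-5493eb38cbb7`), Def 3.5 (i)–(iii) pp.74–75.  The path
functor `DiagramOfCategories.pathFunctor` of `DiagramsOfCategories.lean` (seat abc-iut-L4-t2, p404096)
is compiled by well-founded recursion (both endpoints are bound after the colon), so `𝒟_[nil] = 𝟭` and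
`𝒟_[γ.cons e] = 𝒟_[γ] ⋙ 𝒟_e` hold only propositionally.  Every CONSTRUCTION of a family of homotopies
(Def 3.5 (ii)) by recursion on paths — the observables `𝔖_log` of Cor 3.6 (iii) / 4.5 (iii), cores,
telecores — is far easier over a definitionally unfolding path functor.  This file provides, once for
all consumers (seats abc-iut-L4-t10, -t12, the Cor 3.6/3.7/4.5 dischargers):

* `DiagramOfCategories.pathFunctor'` — `𝒟_[γ]` by STRUCTURAL recursion (initial vertex fixed), with
  `pathFunctor'_nil` / `pathFunctor'_cons` by `rfl`, `pathFunctor'_comp`, and the bridge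
  `pathFunctor_eq_pathFunctor' : 𝒟.pathFunctor γ = 𝒟.pathFunctor' γ`;
* `DiagramOfCategories.HomotopyFamily.mkOfStrict` — a `HomotopyFamily` (t2's structure, axioms stated
  over `pathFunctor`) from homotopies between the strict path functors satisfying the identity /
  composition / whiskering axioms there (transport via `whisker_conj_eqToHom`);
The core toolkits proper (normalised functors to the core vertex ⇒ core observable) are
`DiagramCores.lean` (seat abc-iut-L4-t5) and `AugmentedCores.lean` (seat abc-iut-L4-t9, which also has
the "paths out of the observation vertex are trivial" lemmas); nothing of them is re-declared here.
-/

namespace Literature.AnabelianGeometry.AbsoluteAnabelian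

open _root_.CategoryTheory _root_.Quiver

universe v u w

section Whisker

variable {A : Type*} [Category A] {B : Type*} [Category B] {C : Type*} [Category C]
  {E : Type*} [Category E]

/-- Whiskering a conjugate `eqToHom ≫ β ≫ eqToHom` on both sides is a conjugate of the whiskering of
`β` (all functors involved being replaced by equal ones) — used for the whiskering axiom of
Def 3.5 (ii). [cite: MochizukiAbsTopIII2015, Definition 3.5 (ii) p.75] -/
theorem whisker_conj_eqToHom {L L' : A ⥤ B} (hL : L = L') {P P' Q Q' : B ⥤ C} (hP : P = P')
    (hQ : Q = Q') {R R' : C ⥤ E} (hR : R = R') (β : P' ⟶ Q') :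
    Functor.whiskerLeft L (Functor.whiskerRight (eqToHom hP ≫ β ≫ eqToHom hQ.symm) R) =
      eqToHom (by rw [hL, hP, hR]) ≫ Functor.whiskerLeft L' (Functor.whiskerRight β R') ≫
        eqToHom (by rw [hL, hQ, hR]) := by
  subst hL hP hQ hR
  simp

end Whisker

namespace DiagramOfCategories

variable {V : Type w} [Quiver.{v} V] (D : DiagramOfCategories.{v, u, w} V)

/-- `𝒟_[γ]` by structural recursion on `γ` (initial vertex fixed): a definitionally unfolding variant of
`DiagramOfCategories.pathFunctor` (`pathFunctor_eq_pathFunctor'`).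
[cite: MochizukiAbsTopIII2015, Definition 3.5 (i) pp.74–75] -/
def pathFunctor' {a : V} : ∀ {b : V}, Path a b → (D.obj a ⥤ D.obj b)
  | _, .nil => 𝟭 _
  | _, .cons p e => pathFunctor' p ⋙ D.map e

/-- `𝒟_[nil] = 𝟭`, definitionally. [cite: MochizukiAbsTopIII2015, Definition 3.5 (i) p.74] -/
@[simp] theorem pathFunctor'_nil (a : V) : D.pathFunctor' (Path.nil : Path a a) = 𝟭 _ := rfl

/-- `𝒟_[γ.cons e] = 𝒟_[γ] ⋙ 𝒟_e`, definitionally. [cite: MochizukiAbsTopIII2015, Definition 3.5 (i) p.74] -/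
@[simp] theorem pathFunctor'_cons {a b c : V} (p : Path a b) (e : b ⟶ c) :
    D.pathFunctor' (p.cons e) = D.pathFunctor' p ⋙ D.map e := rfl

/-- `𝒟_[γ₂ ∘ γ₁] = 𝒟_[γ₁] ⋙ 𝒟_[γ₂]` for the structural variant.
[cite: MochizukiAbsTopIII2015, Definition 3.5 (i) pp.74–75] -/
theorem pathFunctor'_comp {a b c : V} (p : Path a b) (q : Path b c) :
    D.pathFunctor' (p.comp q) = D.pathFunctor' p ⋙ D.pathFunctor' q := by
  induction q with
  | nil => rfl
  | cons q e ih => rw [Path.comp_cons, pathFunctor'_cons, pathFunctor'_cons, ih]; rfl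

/-- The two path functors agree. [cite: MochizukiAbsTopIII2015, Definition 3.5 (i) pp.74–75] -/
theorem pathFunctor_eq_pathFunctor' {a : V} : ∀ {b : V} (p : Path a b),
    D.pathFunctor p = D.pathFunctor' p
  | _, .nil => by rw [pathFunctor_nil]; rfl
  | _, .cons p e => by rw [pathFunctor_cons, pathFunctor_eq_pathFunctor' p]; rfl

/-- Objects: `𝒟_[γ₂ ∘ γ₁] x = 𝒟_[γ₂] (𝒟_[γ₁] x)` (structural variant).
[cite: MochizukiAbsTopIII2015, Definition 3.5 (i) pp.74–75] -/
theorem pathFunctor'_comp_obj {a b c : V} (p : Path a b) (q : Path b c) (x : D.obj a) :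
    (D.pathFunctor' (p.comp q)).obj x = (D.pathFunctor' q).obj ((D.pathFunctor' p).obj x) :=
  Functor.congr_obj (D.pathFunctor'_comp p q) x

variable {D}

/-- **Families of homotopies from strict data.**  A family of homotopies (Def 3.5 (ii)) on `𝒟` may be
given by homotopies between the structural path functors `pathFunctor'` satisfying the identity /
composition / whiskering axioms there; transport along `pathFunctor_eq_pathFunctor'` yields a family in
the sense of `DiagramOfCategories.HomotopyFamily`.
[cite: MochizukiAbsTopIII2015, Definition 3.5 (ii) p.75] -/
def HomotopyFamily.mkOfStrict (E : ∀ ⦃a b : V⦄, Path a b → Path a b → Prop) (hE : IsSaturated E)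
    (η' : ∀ ⦃a b : V⦄ ⦃p q : Path a b⦄, E p q → (D.pathFunctor' p ⟶ D.pathFunctor' q))
    (h_refl : ∀ ⦃a b : V⦄ ⦃p : Path a b⦄ (h : E p p), η' h = 𝟙 _)
    (h_trans : ∀ ⦃a b : V⦄ ⦃p q r : Path a b⦄ (h₁ : E p q) (h₂ : E q r),
      η' (hE.trans h₁ h₂) = η' h₁ ≫ η' h₂)
    (h_whisker : ∀ ⦃a b c d : V⦄ ⦃p q : Path a b⦄ (h : E p q) (r₁ : Path c a) (r₂ : Path b d),
      η' (hE.precomp (hE.postcomp h r₂) r₁) =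
        eqToHom (by rw [pathFunctor'_comp, pathFunctor'_comp]) ≫
          Functor.whiskerLeft (D.pathFunctor' r₁)
            (Functor.whiskerRight (η' h) (D.pathFunctor' r₂)) ≫
          eqToHom (by rw [pathFunctor'_comp, pathFunctor'_comp])) :
    D.HomotopyFamily where
  E := E
  isSaturated := hE
  η := fun ⦃_ _ p q⦄ h =>
    eqToHom (D.pathFunctor_eq_pathFunctor' p) ≫ η' h ≫ eqToHom (D.pathFunctor_eq_pathFunctor' q).symm
  η_refl := by intro a b p h; simp [h_refl]
  η_trans := by intro a b p q r h₁ h₂; rw [h_trans h₁ h₂]; simp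
  η_whisker := by
    intro a b c d p q h r₁ r₂
    rw [h_whisker h r₁ r₂, whisker_conj_eqToHom (D.pathFunctor_eq_pathFunctor' r₁)
      (D.pathFunctor_eq_pathFunctor' p) (D.pathFunctor_eq_pathFunctor' q)
      (D.pathFunctor_eq_pathFunctor' r₂) (η' h)]
    simp

end DiagramOfCategories


end Literature.AnabelianGeometry.AbsoluteAnabelian
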